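import Summits.AnomalousDissipation.AnomalousDissipation.Theorems.SolenoidalFractalHomogenisationLagrangianStepSidebandSlot
import Summits.AnomalousDissipation.AnomalousDissipation.Theorems.SolenoidalFractalHomogenisationLagrangianStepSidebandResponse
import Summits.AnomalousDissipation.AnomalousDissipation.Theorems.SolenoidalFractalHomogenisationLagrangianStepSidebandConjFibre
import Summits.AnomalousDissipation.AnomalousDissipation.Theorems.SolenoidalFractalHomogenisationLagrangianStepCellChainDuhamel
import Summits.AnomalousDissipation.AnomalousDissipation.Theorems.SolenoidalFractalHomogenisationLagrangianStepCellChainSlotWindow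
import HarnessLib

/-!
# K1L_D `stub_D1_exactFamily` clause (i) (`stub_D1_residue`, registry v16) — brick A1(c)-II: THE OWN-SLOT DUHAMEL FORMULA for the sideband
# amplitudes `(N t v)_{±mⱼ}` of ANY periodic response of slot `j`, evenness and dissipativity of the block generator
# (helper; `--supports stmt-AnomalousDissipation-27980`)

Summits-side helper file of route `SolenoidalFractalHomogenisation` (prover seat `ad-sawtooth-k1loc-p1` g12; variant A of D26-6/D26-7; identification
`diag psiStar = excQS`, `κ = 1`, behind `WCrossing.ΨB₁` p687442, numerically confirmed j322426).  Everything proved; no definitions, no named facts, no sorry.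

For a lattice word `W₁`, tensor `𝔸`, `γ₁`, truncation `R` with `±mⱼ` retained, and ANY `N` with `Sideband.IsPeriodicResponse W₁ 𝔸 γ₁ R j N`:
* `slotEnvelope_eq_zero_of_mem_slot` / `slotEnvelope_eq_trapezoid_of_mem_slot` — on `[startⱼ, startⱼ + τⱼ)` the other envelopes vanish and the own
  one is the plain trapezoid (`CellChain.slot_window` at period index `0`);
* **`coordL_response_eq_duhamel_self` / `_neg`** — for `t ∈ [startⱼ, startⱼ + τⱼ]`,
  `(N t v)_{mⱼ} = exp((t − startⱼ)·Bⱼ) (N startⱼ v)_{mⱼ} + ∫_{startⱼ}^{t} exp((t − s)·Bⱼ) (−2πi envⱼ(s) αⱼ • P_{mⱼ} v) ds`, `Bⱼ = blockGen 𝔸 γ₁ mⱼ`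
  (real scalars), and the same at `−mⱼ` with `ᾱⱼ`: the fibre is closed during its slot (`…SidebandSlot.coordL_gen_of_slot`) and the variation of
  constants formula `CellChain.eq_exp_add_integral_of_hasDerivAt` applies to the closed fibre equation;
* `blockGen_neg` (`B(−m) = B(m)`), **`real_inner_blockGen_le`** (`⟪B u, u⟫_ℝ ≤ −min(γ₁, 4π²lo')‖u‖²` for `NearIso 𝔸 lo' hi'`, `m ≠ 0`),
  `norm_exp_blockGen_le` (`‖exp(τ·B) u‖ ≤ e^{−min(γ₁,4π²lo')τ}‖u‖`, `τ ≥ 0`) — the first term above is the (exponentially small) wrap-around memory.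
Next brick (A1(c)-III): `feedbackⱼ(t) ∘ N t = (1/(2|mⱼ|²))·envⱼ(t) ∫ envⱼ(s) exp((t−s)Bⱼ) P ds + wrap`, the time substitution to slot time and the
identification of `exp(u·Bⱼ) P` with `NormedSpace.exp (−(T u) • regBlock S m̂ⱼ) * projPerp` for `𝔸 = ν•S` (`⇒ M_{jj} = slotCoefⱼ·(4π²/ν)·slotQⱼ`).
NOT a proof of any registered stub, of the crux, or of anomalous dissipation; rung leaf F-D1 infrastructure.
-/

set_option linter.dupNamespace false

noncomputable section

namespace Summit.AnomalousDissipation.AnomalousDissipation.Theorems.SolenoidalFractalHomogenisation.LagrangianStep.Sideband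

open Set MeasureTheory Complex NormedSpace intervalIntegral
open scoped InnerProductSpace
open Literature.Analysis Literature.Analysis.FunctionSpaces Literature.Analysis.FunctionSpaces.Torus
open Literature.Analysis.FluidPDE Literature.Analysis.FluidPDE.Torus Literature.Analysis.FluidPDE.LatticeShear
open Summit.AnomalousDissipation.AnomalousDissipation.Theorems.SolenoidalFractalHomogenisation.LagrangianStep.CellChain
  (linkCoeff eq_exp_add_integral_of_hasDerivAt slot_window norm_transversalProj_le)
open Summit.AnomalousDissipation.AnomalousDissipation.Theorems.SolenoidalFractalHomogenisation.PermissibleCarrier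
  (start_nonneg start_add_tau_le_period period_pos)
open Summit.AnomalousDissipation.AnomalousDissipation.Theorems.SolenoidalFractalHomogenisation.RealisedQuasiStaticCellLaw (trapezoid_eq_zero_of_ne)

variable {k₀ : ℕ}

/-! ## §1 Slot times -/

/-- During slot `j` (absolute times `[startⱼ, startⱼ + τⱼ)` of the first period) every other envelope vanishes. [folklore] -/
theorem slotEnvelope_eq_zero_of_mem_slot (W₁ : LatticeWord k₀) {j j' : Fin k₀} (hj : j' ≠ j) {t : ℝ}
    (ht : t ∈ Ico (W₁.start j) (W₁.start j + (W₁.phase j).τ)) : slotEnvelope W₁ j' t = 0 := by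
  have h := slot_window W₁ j 0 (t := t) (by simpa using ht)
  rw [slotEnvelope_def]
  exact trapezoid_eq_zero_of_ne W₁ hj h.2.1

/-- During slot `j` the own envelope is the plain trapezoid of the slot. [folklore] -/
theorem slotEnvelope_eq_trapezoid_of_mem_slot (W₁ : LatticeWord k₀) (j : Fin k₀) {t : ℝ}
    (ht : t ∈ Ico (W₁.start j) (W₁.start j + (W₁.phase j).τ)) :
    slotEnvelope W₁ j t = LatticeWord.trapezoid (W₁.start j) (W₁.phase j).τ W₁.ramp t := by
  have h := slot_window W₁ j 0 (t := t) (by simpa using ht)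
  rw [slotEnvelope_def, h.2.2]
  simp

/-- Slot `j` lies inside the first period: `startⱼ ≤ t < startⱼ + τⱼ ⇒ t ∈ [0, P)`. [folklore] -/
theorem mem_Ico_period_of_mem_slot (W₁ : LatticeWord k₀) (j : Fin k₀) {t : ℝ}
    (ht : t ∈ Ico (W₁.start j) (W₁.start j + (W₁.phase j).τ)) : t ∈ Ico 0 W₁.period :=
  ⟨(start_nonneg W₁ j).trans ht.1, lt_of_lt_of_le ht.2 (start_add_tau_le_period W₁ j)⟩

/-! ## §2 The block generator: evenness and dissipativity -/

/-- `B(−m) = B(m)` (the Leray projection and the symbol matrix are even in the wave vector). [cite: Frisch1995Turbulence, §9.6.3 eq. (9.57) p. 233] -/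
theorem blockGen_neg (𝔸 : Torus.Visc4 (Fin 3)) (γ₁ : ℝ) (m : Fin 3 → ℤ) : blockGen 𝔸 γ₁ (-m) = blockGen 𝔸 γ₁ m := by
  ext u : 1
  simp only [blockGen_apply, transversalProj_neg_wave, symbT_neg_wave]

/-- **Dissipativity of the block generator**: for `NearIso 𝔸 lo' hi'`, `lo' ≥ 0`, `m ≠ 0`: `⟪B u, u⟫_ℝ ≤ −min(γ₁, 4π²lo')·‖u‖²`.
[cite: Frisch1995Turbulence, §9.6.3 eq. (9.57) p. 233] [cite: SandersVerhulstMurdock2007, Lemma 5.2.7 (linear case)] -/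
theorem real_inner_blockGen_le {𝔸 : Torus.Visc4 (Fin 3)} {lo' hi' : ℝ} (h𝔸 : Torus.NearIso 𝔸 lo' hi') (hlo' : 0 ≤ lo') (γ₁ : ℝ)
    {m : Fin 3 → ℤ} (hm : m ≠ 0) (u : EuclideanSpace ℂ (Fin 3)) :
    ⟪blockGen 𝔸 γ₁ m u, u⟫_ℝ ≤ -(min γ₁ (4 * Real.pi ^ 2 * lo')) * ‖u‖ ^ 2 := by
  have h1 := re_inner_transversalProj_symbT_ge h𝔸 hlo' hm u
  have h2 := re_inner_sub_transversalProj m u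
  have h3 : ‖transversalProj m u‖ ^ 2 ≤ ‖u‖ ^ 2 := pow_le_pow_left₀ (norm_nonneg _) (norm_transversalProj_le m u) 2
  have hre : ⟪blockGen 𝔸 γ₁ m u, u⟫_ℝ =
      -(4 * Real.pi ^ 2 * (⟪transversalProj m (Torus.symbT (Torus.majorTranspose 𝔸) m (transversalProj m u)), u⟫_ℂ).re) -
        γ₁ * (‖u‖ ^ 2 - ‖transversalProj m u‖ ^ 2) := by
    have hre' : ⟪blockGen 𝔸 γ₁ m u, u⟫_ℝ = (⟪blockGen 𝔸 γ₁ m u, u⟫_ℂ).re := real_inner_eq_re_inner ℂ _ _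
    rw [hre', blockGen_apply, inner_sub_left, inner_neg_left, inner_smul_left, inner_smul_left, Complex.sub_re,
      Complex.neg_re, Complex.conj_ofReal, Complex.conj_ofReal, Complex.re_ofReal_mul, Complex.re_ofReal_mul, h2]
  rw [hre]
  have hμ1 : min γ₁ (4 * Real.pi ^ 2 * lo') ≤ γ₁ := min_le_left _ _
  have hμ2 : min γ₁ (4 * Real.pi ^ 2 * lo') ≤ 4 * Real.pi ^ 2 * lo' := min_le_right _ _
  have ha : 0 ≤ ‖transversalProj m u‖ ^ 2 := sq_nonneg _
  nlinarith [h1, h3, hμ1, hμ2, ha, sub_nonneg.2 h3, Real.pi_pos]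

/-- Coercivity of `−B` as a real operator (the hypothesis of `PeriodicAveraging.norm_exp_neg_smul_apply_le`). [cite: SandersVerhulstMurdock2007, Lemma 5.2.7] -/
theorem coercive_neg_blockGen {𝔸 : Torus.Visc4 (Fin 3)} {lo' hi' : ℝ} (h𝔸 : Torus.NearIso 𝔸 lo' hi') (hlo' : 0 ≤ lo') (γ₁ : ℝ)
    {m : Fin 3 → ℤ} (hm : m ≠ 0) (u : EuclideanSpace ℂ (Fin 3)) :
    min γ₁ (4 * Real.pi ^ 2 * lo') * ‖u‖ ^ 2 ≤ ⟪(-((blockGen 𝔸 γ₁ m).restrictScalars ℝ)) u, u⟫_ℝ := by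
  have h := real_inner_blockGen_le h𝔸 hlo' γ₁ hm u
  rw [neg_apply, ContinuousLinearMap.coe_restrictScalars', inner_neg_left]
  linarith

/-- **Contraction of the block semigroup**: `‖exp(τ·B) u‖ ≤ e^{−min(γ₁,4π²lo')τ}·‖u‖` for `τ ≥ 0`. [cite: SandersVerhulstMurdock2007, Lemma 5.2.7] -/
theorem norm_exp_blockGen_le {𝔸 : Torus.Visc4 (Fin 3)} {lo' hi' : ℝ} (h𝔸 : Torus.NearIso 𝔸 lo' hi') (hlo' : 0 ≤ lo') (γ₁ : ℝ)
    {m : Fin 3 → ℤ} (hm : m ≠ 0) (u : EuclideanSpace ℂ (Fin 3)) {τ : ℝ} (hτ : 0 ≤ τ) :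
    ‖exp (τ • (blockGen 𝔸 γ₁ m).restrictScalars ℝ) u‖ ≤ Real.exp (-(min γ₁ (4 * Real.pi ^ 2 * lo') * τ)) * ‖u‖ := by
  have h := Literature.Analysis.ODE.PeriodicAveraging.norm_exp_neg_smul_apply_le (-((blockGen 𝔸 γ₁ m).restrictScalars ℝ))
    (coercive_neg_blockGen h𝔸 hlo' γ₁ hm) u hτ
  rwa [smul_neg, neg_neg] at h

/-! ## §3 The own-slot Duhamel formula -/

/-- The orbit `s ↦ N s v` of a periodic response solves `y' = sourceⱼ(s) v + gen(s) y` on `[0, P)`. [cite: SandersVerhulstMurdock2007, Lemma 5.2.7] -/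
theorem hasDerivAt_response_apply (W₁ : LatticeWord k₀) (𝔸 : Torus.Visc4 (Fin 3)) (γ₁ : ℝ) (R : ℕ) (j : Fin k₀)
    {N : ℝ → (EuclideanSpace ℂ (Fin 3) →L[ℝ] Space R)} (hN : IsPeriodicResponse W₁ 𝔸 γ₁ R j N) (v : EuclideanSpace ℂ (Fin 3))
    {s : ℝ} (hs : s ∈ Ico 0 W₁.period) :
    HasDerivAt (fun s => N s v) (source W₁ R j s v + ((gen W₁ 𝔸 γ₁ R s).restrictScalars ℝ) (N s v)) s := by
  have h := (hN.2.1 s hs).clm_apply (hasDerivAt_const s v)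
  refine h.congr_deriv ?_
  simp only [add_apply, ContinuousLinearMap.comp_apply, ContinuousLinearMap.coe_restrictScalars', map_zero, add_zero]

/-- The orbit read on a fibre is continuous on `[0, P]`. [cite: SandersVerhulstMurdock2007, Lemma 5.2.7] -/
theorem continuousOn_coordL_response (W₁ : LatticeWord k₀) (𝔸 : Torus.Visc4 (Fin 3)) (γ₁ : ℝ) (R : ℕ) (j : Fin k₀)
    {N : ℝ → (EuclideanSpace ℂ (Fin 3) →L[ℝ] Space R)} (hN : IsPeriodicResponse W₁ 𝔸 γ₁ R j N) (v : EuclideanSpace ℂ (Fin 3))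
    (m : Fin 3 → ℤ) : ContinuousOn (fun s => coordL R m (N s v)) (Icc 0 W₁.period) :=
  (coordL R m).continuous.comp_continuousOn (hN.1.clm_apply continuousOn_const)

/-- **OWN-SLOT DUHAMEL FORMULA at `mⱼ`.**  For any periodic response `N` of slot `j` (fibre `mⱼ` retained) and `t ∈ [startⱼ, startⱼ + τⱼ]`:
`(N t v)_{mⱼ} = exp((t − startⱼ)·B) (N startⱼ v)_{mⱼ} + ∫_{startⱼ}^{t} exp((t − s)·B) (−2πi envⱼ(s) αⱼ • P_{mⱼ} v) ds`, `B = blockGen 𝔸 γ₁ mⱼ` over `ℝ`.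
[cite: Hale1980, Ch. III §1, Theorem 1.1 (variation of constants formula)] [cite: MajdaKramer1999, §2.2.1.3 (cell problem (49))] -/
theorem coordL_response_eq_duhamel_self (W₁ : LatticeWord k₀) (𝔸 : Torus.Visc4 (Fin 3)) (γ₁ : ℝ) (R : ℕ) (j : Fin k₀)
    {N : ℝ → (EuclideanSpace ℂ (Fin 3) →L[ℝ] Space R)} (hN : IsPeriodicResponse W₁ 𝔸 γ₁ R j N) (hm : (W₁.phase j).m ∈ box R)
    (v : EuclideanSpace ℂ (Fin 3)) {t : ℝ} (ht : t ∈ Icc (W₁.start j) (W₁.start j + (W₁.phase j).τ)) :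
    coordL R (W₁.phase j).m (N t v) =
      exp ((t - W₁.start j) • (blockGen 𝔸 γ₁ (W₁.phase j).m).restrictScalars ℝ) (coordL R (W₁.phase j).m (N (W₁.start j) v)) +
      ∫ s in W₁.start j..t, exp ((t - s) • (blockGen 𝔸 γ₁ (W₁.phase j).m).restrictScalars ℝ)
        ((-(2 * Real.pi * Complex.I * ((slotEnvelope W₁ j s : ℝ) : ℂ) * slotAmp W₁ j)) • transversalProj (W₁.phase j).m v) := by
  set m := (W₁.phase j).m with hmdef
  set G : EuclideanSpace ℂ (Fin 3) →L[ℝ] EuclideanSpace ℂ (Fin 3) := -((blockGen 𝔸 γ₁ m).restrictScalars ℝ) with hG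
  set x : ℝ → EuclideanSpace ℂ (Fin 3) := fun s => coordL R m (N s v) with hx
  set f : ℝ → EuclideanSpace ℂ (Fin 3) := fun s =>
    (-(2 * Real.pi * Complex.I * ((slotEnvelope W₁ j s : ℝ) : ℂ) * slotAmp W₁ j)) • transversalProj m v with hf
  have hsP := start_add_tau_le_period W₁ j
  have hs0 := start_nonneg W₁ j
  have hxc : ContinuousOn x (Icc (W₁.start j) t) :=
    (continuousOn_coordL_response W₁ 𝔸 γ₁ R j hN v m).mono (Icc_subset_Icc hs0 (ht.2.trans hsP))
  have hfc : ContinuousOn f (Icc (W₁.start j) t) := by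
    refine Continuous.continuousOn ?_
    exact (((continuous_const.mul (Complex.continuous_ofReal.comp (continuous_slotEnvelope W₁ j))).mul continuous_const).neg.smul
      continuous_const)
  have hxd : ∀ s ∈ Ioo (W₁.start j) t, HasDerivAt x (-(G (x s)) + f s) s := by
    intro s hs
    have hslot : s ∈ Ico (W₁.start j) (W₁.start j + (W₁.phase j).τ) := ⟨hs.1.le, lt_of_lt_of_le hs.2 ht.2⟩
    have hoff : ∀ j', j' ≠ j → slotEnvelope W₁ j' s = 0 := fun j' hj' => slotEnvelope_eq_zero_of_mem_slot W₁ hj' hslot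
    have h1 := hasDerivAt_response_apply W₁ 𝔸 γ₁ R j hN v (mem_Ico_period_of_mem_slot W₁ j hslot)
    have h2 := hasDerivAt_coordL_of_slot W₁ 𝔸 γ₁ R j hoff (Or.inl hmdef) h1
    refine h2.congr_deriv ?_
    rw [coordL_source_self W₁ j s hm, hG, neg_apply, ContinuousLinearMap.coe_restrictScalars', neg_neg, add_comm]
  have hD := eq_exp_add_integral_of_hasDerivAt G ht.1 hxc hfc hxd
  simp only [hG, smul_neg, neg_neg] at hD
  exact hD

/-- **OWN-SLOT DUHAMEL FORMULA at `−mⱼ`** (conjugate amplitude `ᾱⱼ`; `blockGen 𝔸 γ₁ (−mⱼ) = blockGen 𝔸 γ₁ mⱼ` by `blockGen_neg`).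
[cite: Hale1980, Ch. III §1, Theorem 1.1 (variation of constants formula)] [cite: MajdaKramer1999, §2.2.1.3 (cell problem (49))] -/
theorem coordL_response_eq_duhamel_neg (W₁ : LatticeWord k₀) (𝔸 : Torus.Visc4 (Fin 3)) (γ₁ : ℝ) (R : ℕ) (j : Fin k₀)
    {N : ℝ → (EuclideanSpace ℂ (Fin 3) →L[ℝ] Space R)} (hN : IsPeriodicResponse W₁ 𝔸 γ₁ R j N) (hm : -(W₁.phase j).m ∈ box R)
    (v : EuclideanSpace ℂ (Fin 3)) {t : ℝ} (ht : t ∈ Icc (W₁.start j) (W₁.start j + (W₁.phase j).τ)) :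
    coordL R (-(W₁.phase j).m) (N t v) =
      exp ((t - W₁.start j) • (blockGen 𝔸 γ₁ (-(W₁.phase j).m)).restrictScalars ℝ) (coordL R (-(W₁.phase j).m) (N (W₁.start j) v)) +
      ∫ s in W₁.start j..t, exp ((t - s) • (blockGen 𝔸 γ₁ (-(W₁.phase j).m)).restrictScalars ℝ)
        ((-(2 * Real.pi * Complex.I * ((slotEnvelope W₁ j s : ℝ) : ℂ) * starRingEnd ℂ (slotAmp W₁ j))) • transversalProj (-(W₁.phase j).m) v) := by
  set m := -(W₁.phase j).m with hmdef
  set G : EuclideanSpace ℂ (Fin 3) →L[ℝ] EuclideanSpace ℂ (Fin 3) := -((blockGen 𝔸 γ₁ m).restrictScalars ℝ) with hG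
  set x : ℝ → EuclideanSpace ℂ (Fin 3) := fun s => coordL R m (N s v) with hx
  set f : ℝ → EuclideanSpace ℂ (Fin 3) := fun s =>
    (-(2 * Real.pi * Complex.I * ((slotEnvelope W₁ j s : ℝ) : ℂ) * starRingEnd ℂ (slotAmp W₁ j))) • transversalProj m v with hf
  have hsP := start_add_tau_le_period W₁ j
  have hs0 := start_nonneg W₁ j
  have hxc : ContinuousOn x (Icc (W₁.start j) t) :=
    (continuousOn_coordL_response W₁ 𝔸 γ₁ R j hN v m).mono (Icc_subset_Icc hs0 (ht.2.trans hsP))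
  have hfc : ContinuousOn f (Icc (W₁.start j) t) := by
    refine Continuous.continuousOn ?_
    exact (((continuous_const.mul (Complex.continuous_ofReal.comp (continuous_slotEnvelope W₁ j))).mul continuous_const).neg.smul
      continuous_const)
  have hxd : ∀ s ∈ Ioo (W₁.start j) t, HasDerivAt x (-(G (x s)) + f s) s := by
    intro s hs
    have hslot : s ∈ Ico (W₁.start j) (W₁.start j + (W₁.phase j).τ) := ⟨hs.1.le, lt_of_lt_of_le hs.2 ht.2⟩
    have hoff : ∀ j', j' ≠ j → slotEnvelope W₁ j' s = 0 := fun j' hj' => slotEnvelope_eq_zero_of_mem_slot W₁ hj' hslot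
    have h1 := hasDerivAt_response_apply W₁ 𝔸 γ₁ R j hN v (mem_Ico_period_of_mem_slot W₁ j hslot)
    have h2 := hasDerivAt_coordL_of_slot W₁ 𝔸 γ₁ R j hoff (Or.inr hmdef) h1
    refine h2.congr_deriv ?_
    rw [coordL_source_neg W₁ j s hm, hG, neg_apply, ContinuousLinearMap.coe_restrictScalars', neg_neg, add_comm]
  have hD := eq_exp_add_integral_of_hasDerivAt G ht.1 hxc hfc hxd
  simp only [hG, smul_neg, neg_neg] at hD
  exact hD

end Summit.AnomalousDissipation.AnomalousDissipation.Theorems.SolenoidalFractalHomogenisation.LagrangianStep.Sideband
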